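import Summits.CriticalPhenomena.CardyFormulaZ2.Theorems.HalfPlaneMarkDensityLaw.Negative.MarkEvents
import Literature.Probability.Percolation.Z2HalfPlaneThreeArm

/-!
# Self-duality of the half-plane arc-crossing function of bond-`ℤ²`, part 2: parity ("at least one")

Support file for the crux `HalfPlaneMarkDensityLaw` (stmt-CriticalPhenomena-5661), line `Sketch`
(a-priori structure of the open stub C⁺: self-duality).  The combinatorial "at least one" half of
planar duality for boundary-arc crossings of the lattice half-plane, by the parity/handshake method
of the tree's rectangle duality (`PlanarDuality.lean`, `exists_topReach_dualBottomSide`), here for a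
coloured set living strictly inside a box `[0,m] × [0,n]` and read along the BOTTOM row:

* `parity_core` (registered form; `parity_core'` with named hypotheses) — if `C` (think: the sites joined inside the half-plane to the target arc) avoids the
  two leftmost columns, the rightmost column and the top row of the box, and along the bottom row
  `(u,0) ∉ C`, `(v,0) ∈ C` (`u ≤ v`), then some bottom face `(i,-1)` with `u ≤ i < v` and a
  bichromatic bottom edge is joined, in the bichromatic face graph `bichromaticGraph C m n` of
  `PlanarDuality.lean`, to a bottom face `(k,-1)` OUTSIDE `[u, v)` with a bichromatic bottom edge.
  (Colour the leftmost column as well; then the rectangle lemmas `odd_card_filter_adj_bottom/top`,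
  `even_card_filter_adj_interior` apply verbatim, the extra colour only adds an isolated vertical
  chain of faces along the left side, and the handshake lemma in the component of the gap faces
  carrying an odd number of them produces the far odd face.)

No percolation enters this file; part 3 reads the conclusion as a dual-open path of `dualConfig ω`.
-/

noncomputable section

namespace Summit.CriticalPhenomena.CardyFormulaZ2.Cruxes.HalfPlaneMarkDensityLaw.SketchLine.SelfDual

open Literature.Probability.Percolation Literature.Probability.LatticeModels
open MeasureTheory Filter Set SimpleGraph Finset
open Summit.CriticalPhenomena.CardyFormulaZ2.Theorems.HalfPlaneMarkDensityLaw.Negative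

/-! ### Elementary facts about the bichromatic face graph of `PlanarDuality.lean` -/

/-- Propositional bookkeeping for the auxiliary colouring `C ∨ (x₀ = 0)` off the left column.
[folklore] -/
theorem iff_not_of_or_iff {p q a b : Prop} (ha : ¬ a) (hb : ¬ b) (h : (p ∨ a) ↔ ¬ (q ∨ b)) : p ↔ ¬ q := by
  tauto

section Graph

variable {c : Site 2 → Prop} {m n : ℕ}

/-- A bottom face `(x₀,-1)` of the dual rectangle is adjacent in the bichromatic face graph only to
the face `(x₀,0)` above it. [folklore] -/
theorem eq_add_of_adj_bottom {z z' : Site 2} (h : (bichromaticGraph c m n).Adj z z') (hz : z 1 = -1) :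
    z' = z + Pi.single 1 1 := by
  obtain ⟨hadj, hzD, hz'D, hlo, -, -⟩ := h
  have hz'1 := (mem_dualRectangle_iff.1 hz'D).2.2.1
  have hlo1 := (mem_rectangle_iff.1 hlo).2.2.1
  rcases stepKind_of_adj hadj with ⟨h0, h1⟩ | ⟨h0, h1⟩ | ⟨h1, h0⟩ | ⟨h1, h0⟩
  · exfalso
    have : sepLo z z' = z' := by
      have : z' = z + Pi.single 0 1 := by simp [Site.eq_iff_two, h0, h1]
      rw [this, sepLo_add_e0]
    rw [this] at hlo1; omega
  · exfalso
    have : sepLo z z' = z := by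
      have : z = z' + Pi.single 0 1 := by simp [Site.eq_iff_two, h0, h1]
      rw [this, sepLo_comm, sepLo_add_e0]
    rw [this] at hlo1; omega
  · simp [Site.eq_iff_two, h0, h1]
  · exfalso; omega

/-- Both endpoints of the primal edge separating two adjacent faces of first coordinate `≥ 1` have
first coordinate `≥ 1`. [folklore] -/
theorem one_le_of_mem_sepEdge {z z' w : Site 2} (hz : 1 ≤ z 0) (hw : w ∈ sepEdge z z') : 1 ≤ w 0 := by
  have := (sepEdge_apply_zero_le hw).2
  have : z 0 ≤ max (z 0) (z' 0) := le_max_left _ _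
  omega

/-- With the left column coloured in addition (`c' = C ∨ (x₀ = 0)`), a bichromatic step between faces
of first coordinate `≥ 1` is bichromatic for `C` itself. [folklore] -/
theorem bichromatic_of_bichromatic_or {C : Site 2 → Prop} {z z' : Site 2} (hz : 1 ≤ z 0)
    (h : Bichromatic (fun x => C x ∨ x 0 = 0) m n z z') : Bichromatic C m n z z' := by
  obtain ⟨hlo, hhi, hc⟩ := h
  refine ⟨hlo, hhi, ?_⟩
  have h1 : 1 ≤ (sepLo z z') 0 := one_le_of_mem_sepEdge hz (by rw [sepEdge]; exact Sym2.mem_mk_left _ _)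
  have h2 : 1 ≤ (sepHi z z') 0 := one_le_of_mem_sepEdge hz (by rw [sepEdge]; exact Sym2.mem_mk_right _ _)
  have h1' : ¬ (sepLo z z') 0 = 0 := by omega
  have h2' : ¬ (sepHi z z') 0 = 0 := by omega
  simpa [h1', h2'] using hc

/-- A walk of the bichromatic face graph for `C ∨ (x₀ = 0)` through faces of first coordinate `≥ 1`
is a walk of the bichromatic face graph for `C`. [folklore] -/
theorem reachable_of_walk_or {C : Site 2 → Prop} {x y : Site 2}
    (W : (bichromaticGraph (fun x => C x ∨ x 0 = 0) m n).Walk x y) (hW : ∀ z ∈ W.support, 1 ≤ z 0) :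
    (bichromaticGraph C m n).Reachable x y := by
  induction W with
  | nil => rfl
  | cons h W ih =>
    rename_i a b e
    have ha : 1 ≤ a 0 := hW a (by simp)
    have hab : (bichromaticGraph C m n).Adj a b :=
      ⟨h.1, h.2.1, h.2.2.1, bichromatic_of_bichromatic_or ha h.2.2.2⟩
    exact hab.reachable.trans (ih fun z hz => hW z (by simp [hz]))

end Graph

/-! ### The parity lemma along the bottom row -/

/-- **Parity along the bottom row.**  Let `C` be a set of sites of the box `[0,m] × [0,n]` avoiding
the columns `x₀ ≤ 1`, the column `x₀ = m` and the row `x₁ = n`, and let `2 ≤ u ≤ v ≤ m-1` with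
`(u,0) ∉ C`, `(v,0) ∈ C`.  Then there are `u ≤ i < v` and `k ∉ [u,v)`, `1 ≤ k ≤ m-1`, such that the
bottom edges `{(i,0),(i+1,0)}` and `{(k,0),(k+1,0)}` are bichromatic and the bottom faces `(i,-1)`,
`(k,-1)` are joined in the bichromatic face graph `bichromaticGraph C m n` (faces of the dual
rectangle, adjacent across bichromatic edges of the box).  [Handshake lemma in the component of the
gap faces `[u,v)` carrying an odd number of odd faces, for the auxiliary colouring `C ∨ (x₀ = 0)`.]
[cite: BollobasRiordan2006, Ch. 3, Lemma 1 (parity proof of "at least one")] -/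
theorem parity_core' {C : Site 2 → Prop} {m n : ℕ} {u v : ℤ}
    (hC : ∀ x, C x → 2 ≤ x 0 ∧ x 0 + 1 ≤ m ∧ x 1 + 1 ≤ n)
    (hu2 : 2 ≤ u) (huv : u ≤ v) (hu : ¬ C ![u, 0]) (hv : C ![v, 0]) :
    ∃ i k : ℤ, u ≤ i ∧ i < v ∧ (k < u ∨ v ≤ k) ∧ 1 ≤ k ∧ k + 1 ≤ m ∧
      (C ![i, 0] ↔ ¬ C ![i + 1, 0]) ∧ (C ![k, 0] ↔ ¬ C ![k + 1, 0]) ∧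
      (bichromaticGraph C m n).Reachable ![i, -1] ![k, -1] := by
  classical
  have hvm : v + 1 ≤ m := (hC _ hv).2.1
  have hn : (1 : ℤ) ≤ n := by have := (hC _ hv).2.2; simp at this; omega
  -- the auxiliary colouring and its face graph
  set c' : Site 2 → Prop := fun x => C x ∨ x 0 = 0 with hc'
  set G := bichromaticGraph c' m n with hG
  have hL : ∀ x ∈ leftSide m n, c' x := fun x hx => Or.inr (Finset.mem_filter.1 hx).2
  have hR : ∀ x ∈ rightSide m n, ¬ c' x := by
    intro x hx
    have hx0 : x 0 = m := (Finset.mem_filter.1 hx).2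
    rintro (h | h)
    · have := (hC x h).2.1; omega
    · omega
  -- parity of the number of bichromatic neighbours of a face of the dual rectangle
  have hodd : ∀ z ∈ dualRectangle m n, Odd #((nbrs z).filter fun z' => G.Adj z z') ↔
      (z 1 = -1 ∧ (c' (z + Pi.single 1 1) ↔ ¬ c' (z + Pi.single 1 1 + Pi.single 0 1))) ∨
        (z 1 = n ∧ z 0 = 0) := by
    intro z hz
    have hzD := mem_dualRectangle_iff.1 hz
    rcases lt_trichotomy (z 1) (-1) with h | h | h
    · omega
    · rw [hG, odd_card_filter_adj_bottom hz h]
      have : ¬ ((-1 : ℤ) = n) := by omega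
      simp only [h, true_and, this, false_and, or_false]
    · rcases lt_or_ge (z 1) n with h' | h'
      · have hzn : ¬ (z 1 = n) := by omega
        have hzm : ¬ (z 1 = -1) := by omega
        simp only [hzn, hzm, false_and, or_self, iff_false, Nat.not_odd_iff_even]
        exact even_card_filter_adj_interior hz hL hR (by omega) (by omega)
      · have hzn : z 1 = n := by omega
        rw [hG, odd_card_filter_adj_top hz hzn]
        have hzm : ¬ ((n : ℤ) = -1) := by omega
        have hCz : ¬ C z := fun hc => by have := (hC z hc).2.2; omega
        have hCz' : ¬ C (z + Pi.single 0 1) := fun hc => by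
          have := (hC _ hc).2.2; simp at this; omega
        have h0 : ¬ ((z + Pi.single 0 1 : Site 2) 0 = 0) := by simp; omega
        simp only [hzn, hzm, false_and, false_or, true_and, hc', hCz, hCz', h0, or_false, false_or,
          not_false_eq_true, iff_true]
  -- the left column is closed under adjacency
  have hcol : ∀ z z' : Site 2, G.Adj z z' → z 0 = 0 → z' 0 = 0 := by
    intro z z' h hz0
    obtain ⟨hadj, hzD, hz'D, hB⟩ := h
    have hz'D' := mem_dualRectangle_iff.1 hz'D
    rcases stepKind_of_adj hadj with ⟨h0, h1⟩ | ⟨h0, h1⟩ | ⟨h1, h0⟩ | ⟨h1, h0⟩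
    · exfalso
      have hzz' : z' = z + Pi.single 0 1 := by simp [Site.eq_iff_two, h0, h1]
      obtain ⟨hlo, hhi, hc⟩ := hB
      rw [hzz', sepLo_add_e0, sepHi_add_e0] at hc
      have e1 : ¬ c' (z + Pi.single 0 1) := by
        rintro (h | h)
        · have := (hC _ h).1; simp at this; omega
        · simp at h; omega
      have e2 : ¬ c' (z + Pi.single 0 1 + Pi.single 1 1) := by
        rintro (h | h)
        · have := (hC _ h).1; simp at this; omega
        · simp at h; omega
      tauto
    · omega
    · omega
    · omega
  have hcolR : ∀ z z' : Site 2, G.Reachable z z' → z 0 = 0 → z' 0 = 0 := by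
    intro z z' ⟨W⟩
    induction W with
    | nil => exact id
    | cons h W ih => exact fun hz => ih (hcol _ _ h hz)
  -- the gap faces with a bichromatic bottom edge: an odd number of them
  set K : ℕ := (v - u).toNat with hK
  have hKuv : (K : ℤ) = v - u := Int.toNat_of_nonneg (by omega)
  set f : ℕ → Prop := fun t => C ![u + t, 0] with hf
  set T : Finset ℕ := (Finset.range K).filter fun t => (f t ↔ ¬ f (t + 1)) with hT
  have hTodd : Odd #T := by
    rw [← Nat.not_even_iff_odd, hT, even_card_changes_iff]
    have h0 : ¬ f 0 := by simpa [hf] using hu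
    have hk : f K := by simp only [hf, hKuv, add_sub_cancel]; exact hv
    tauto
  -- some component of `G` carries an odd number of them
  set comp : ℕ → G.ConnectedComponent := fun t => G.connectedComponentMk ![u + t, -1] with hcomp
  obtain ⟨cpt, hcpt, hfib⟩ : ∃ cpt ∈ T.image comp, Odd #(T.filter fun t => comp t = cpt) := by
    by_contra hall
    push Not at hall
    have hsum := Finset.card_eq_sum_card_fiberwise (f := comp) (s := T) (t := T.image comp)
      fun t ht => Finset.mem_image_of_mem _ ht
    have heven : Even (∑ b ∈ T.image comp, #(T.filter fun t => comp t = b)) :=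
      Finset.even_sum _ fun b hb => Nat.not_odd_iff_even.1 (hall b hb)
    rw [← hsum] at heven
    exact Nat.not_even_iff_odd.2 hTodd heven
  obtain ⟨t₀, ht₀T, ht₀⟩ : ∃ t₀ ∈ T, comp t₀ = cpt := by simpa using hcpt
  -- faces of the gap have first coordinate ≥ 2, so the component avoids the left column
  have hgap0 : ∀ t : ℕ, t < K → (2 : ℤ) ≤ u + t := fun t _ => by omega
  have hKcol : ∀ z : Site 2, G.connectedComponentMk z = cpt → z 0 ≠ 0 := by
    intro z hz h0
    have hreach : G.Reachable z ![u + t₀, -1] :=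
      SimpleGraph.ConnectedComponent.exact (hz.trans ht₀.symm)
    have := hcolR _ _ hreach h0
    have ht₀K : t₀ < K := Finset.mem_range.1 (Finset.mem_filter.1 ht₀T).1
    simp at this; omega
  -- the faces of the dual rectangle in that component
  set Kf : Finset (Site 2) := (dualRectangle m n).filter fun z => G.connectedComponentMk z = cpt with hKf
  -- handshake in the induced graph
  set H : SimpleGraph ↥(↑Kf : Set (Site 2)) := G.induce ↑Kf with hH
  have hdeg : ∀ w : ↥(↑Kf : Set (Site 2)), H.degree w = #((nbrs (w : Site 2)).filter fun z' => G.Adj w z') := by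
    intro w
    rw [← SimpleGraph.card_neighborFinset_eq_degree, ← Finset.card_map (Function.Embedding.subtype _)]
    congr 1
    ext z'
    simp only [Finset.mem_map, SimpleGraph.mem_neighborFinset, Function.Embedding.coe_subtype,
      Finset.mem_filter, Subtype.exists, exists_and_right, exists_eq_right, hH, SimpleGraph.comap_adj,
      SimpleGraph.induce]
    constructor
    · rintro ⟨hz', h⟩
      exact ⟨mem_nbrs_of_adj h.1, h⟩
    · rintro ⟨-, h⟩
      refine ⟨?_, h⟩
      rw [Finset.mem_coe, hKf, Finset.mem_filter]
      refine ⟨h.2.2.1, ?_⟩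
      rw [← (Finset.mem_filter.1 w.2).2]
      exact SimpleGraph.ConnectedComponent.sound h.symm.reachable
  have hand := H.even_card_odd_degree_vertices
  -- transport the handshake to a statement about `Kf`
  set P : Site 2 → Prop := fun z => z 1 = -1 ∧ (c' (z + Pi.single 1 1) ↔ ¬ c' (z + Pi.single 1 1 + Pi.single 0 1)) with hP
  have hcardP : #(Finset.univ.filter fun w : ↥(↑Kf : Set (Site 2)) => Odd (H.degree w)) = #(Kf.filter P) := by
    refine Finset.card_bij (fun w _ => (w : Site 2)) ?_ ?_ ?_
    · intro w hw
      have hwK : (w : Site 2) ∈ Kf := w.2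
      rw [Finset.mem_filter] at hw ⊢
      refine ⟨hwK, ?_⟩
      have hwD : (w : Site 2) ∈ dualRectangle m n := (Finset.mem_filter.1 hwK).1
      have h := (hodd _ hwD).1 (by rw [← hdeg]; exact hw.2)
      rcases h with h | h
      · exact h
      · exact absurd h.2 (hKcol _ (Finset.mem_filter.1 hwK).2)
    · intro w₁ _ w₂ _ h
      exact Subtype.ext h
    · intro z hz
      rw [Finset.mem_filter] at hz
      refine ⟨⟨z, Finset.mem_coe.2 hz.1⟩, ?_, rfl⟩
      rw [Finset.mem_filter]
      refine ⟨Finset.mem_univ _, ?_⟩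
      rw [hdeg]
      exact (hodd _ (Finset.mem_filter.1 hz.1).1).2 (Or.inl hz.2)
  rw [hcardP] at hand
  -- split the odd faces of the component into gap faces and the others
  set Pg : Site 2 → Prop := fun z => u ≤ z 0 ∧ z 0 < v with hPg
  have hsplit : #(Kf.filter P) = #((Kf.filter P).filter Pg) + #((Kf.filter P).filter fun z => ¬ Pg z) :=
    (Finset.card_filter_add_card_filter_not Pg).symm
  -- the gap part is in bijection with the odd fibre
  have hgap : #((Kf.filter P).filter Pg) = #(T.filter fun t => comp t = cpt) := by
    symm
    refine Finset.card_bij (fun t _ => (![u + t, -1] : Site 2)) ?_ ?_ ?_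
    · intro t ht
      rw [Finset.mem_filter] at ht
      obtain ⟨htT, htc⟩ := ht
      obtain ⟨htK, htf⟩ := Finset.mem_filter.1 htT
      rw [Finset.mem_range] at htK
      have hD : (![u + t, -1] : Site 2) ∈ dualRectangle m n := by
        rw [mem_dualRectangle_iff]; simp; omega
      have e1 : (![u + t, -1] : Site 2) + Pi.single 1 1 = ![u + t, 0] := by
        ext i; fin_cases i <;> simp
      have e2 : (![u + t, 0] : Site 2) + Pi.single 0 1 = ![u + (t + 1 : ℕ), 0] := by
        ext i; fin_cases i <;> simp; ring
      have n1 : ¬ ((![u + t, 0] : Site 2) 0 = 0) := by simp; omega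
      have n2 : ¬ ((![u + (t + 1 : ℕ), 0] : Site 2) 0 = 0) := by simp; omega
      have hPz : P ![u + t, -1] := by
        refine ⟨by simp, ?_⟩
        rw [e1, e2]
        simp only [hc', n1, n2, or_false]
        exact htf
      have hPgz : Pg ![u + t, -1] := by simp only [hPg]; simp; omega
      exact Finset.mem_filter.2 ⟨Finset.mem_filter.2 ⟨Finset.mem_filter.2 ⟨hD, htc⟩, hPz⟩, hPgz⟩
    · intro t₁ _ t₂ _ h
      have := congr_fun h 0
      simp at this
      omega
    · intro z hz
      simp only [Finset.mem_filter, hKf, hP, hPg] at hz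
      obtain ⟨⟨⟨hzD, hzc⟩, hz1, hzb⟩, hzu, hzv⟩ := hz
      refine ⟨(z 0 - u).toNat, ?_, ?_⟩
      · have ht : ((z 0 - u).toNat : ℤ) = z 0 - u := Int.toNat_of_nonneg (by omega)
        rw [Finset.mem_filter, hT, Finset.mem_filter, Finset.mem_range]
        have hz' : (![u + ((z 0 - u).toNat : ℕ), -1] : Site 2) = z := by
          ext i; fin_cases i <;> simp [ht, hz1]
        refine ⟨⟨by omega, ?_⟩, by rw [hcomp]; simp only [hz']; exact hzc⟩
        have e1 : z + Pi.single 1 1 = ![u + ((z 0 - u).toNat : ℕ), 0] := by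
          ext i; fin_cases i <;> simp [ht, hz1]
        have e2 : (![u + ((z 0 - u).toNat : ℕ), 0] : Site 2) + Pi.single 0 1 =
            ![u + (((z 0 - u).toNat + 1 : ℕ)), 0] := by
          ext i; fin_cases i <;> simp; ring
        rw [e1, e2] at hzb
        have n1 : ¬ ((![u + ((z 0 - u).toNat : ℕ), 0] : Site 2) 0 = 0) := by simp; omega
        have n2 : ¬ ((![u + (((z 0 - u).toNat + 1 : ℕ)), 0] : Site 2) 0 = 0) := by simp; omega
        exact iff_not_of_or_iff n1 n2 hzb
      · have ht : ((z 0 - u).toNat : ℤ) = z 0 - u := Int.toNat_of_nonneg (by omega)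
        ext i; fin_cases i <;> simp [ht, hz1]
  -- hence the other part is odd, in particular nonempty
  have hrest : Odd #((Kf.filter P).filter fun z => ¬ Pg z) := by
    rw [hsplit, hgap] at hand
    rcases Nat.even_or_odd #((Kf.filter P).filter fun z => ¬ Pg z) with h | h
    · exact absurd hand (Nat.not_even_iff_odd.2 (hfib.add_even h))
    · exact h
  obtain ⟨z, hz⟩ : ((Kf.filter P).filter fun z => ¬ Pg z).Nonempty := Finset.card_pos.1 hrest.pos
  simp only [Finset.mem_filter, hKf, hP, hPg, not_and_or, not_le, not_lt] at hz
  obtain ⟨⟨⟨hzD, hzc⟩, hz1, hzb⟩, hzg⟩ := hz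
  have hzD' := mem_dualRectangle_iff.1 hzD
  have hz0 : z 0 ≠ 0 := hKcol z hzc
  -- the two faces and the path between them
  set k := z 0 with hk
  have hzk : z = ![k, -1] := by ext i; fin_cases i <;> simp [hk, hz1]
  refine ⟨u + t₀, k, by omega, ?_, by omega, by omega, by omega, ?_, ?_, ?_⟩
  · have := Finset.mem_range.1 (Finset.mem_filter.1 ht₀T).1; omega
  · have htf := (Finset.mem_filter.1 ht₀T).2
    have e : u + (t₀ : ℤ) + 1 = u + ((t₀ + 1 : ℕ) : ℤ) := by push_cast; ring
    rw [e]; exact htf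
  · have e1 : z + Pi.single 1 1 = ![k, 0] := by ext i; fin_cases i <;> simp [hk, hz1]
    have e2 : (![k, 0] : Site 2) + Pi.single 0 1 = ![k + 1, 0] := by ext i; fin_cases i <;> simp
    rw [e1, e2] at hzb
    have n1 : ¬ ((![k, 0] : Site 2) 0 = 0) := by simp; omega
    have n2 : ¬ ((![k + 1, 0] : Site 2) 0 = 0) := by simp; omega
    exact iff_not_of_or_iff n1 n2 hzb
  · have hreach : G.Reachable ![u + t₀, -1] z := SimpleGraph.ConnectedComponent.exact (ht₀.trans hzc.symm)
    rw [hzk] at hreach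
    obtain ⟨W⟩ := hreach
    -- every face of the walk lies in the dual rectangle and in the component, hence off the left column
    have hstart : (![u + t₀, -1] : Site 2) ∈ dualRectangle m n := by
      have := Finset.mem_range.1 (Finset.mem_filter.1 ht₀T).1
      rw [mem_dualRectangle_iff]; simp; omega
    have hsupp : ∀ {x y : Site 2} (W' : G.Walk x y), x ∈ dualRectangle m n →
        ∀ w ∈ W'.support, w ∈ dualRectangle m n := by
      intro x y W' hx
      induction W' with
      | nil => intro w hw; rw [Walk.support_nil, List.mem_singleton] at hw; rw [hw]; exact hx
      | cons h W' ih =>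
        intro w hw
        rw [Walk.support_cons, List.mem_cons] at hw
        rcases hw with rfl | hw
        · exact hx
        · exact ih h.2.2.1 w hw
    refine reachable_of_walk_or W fun w hw => ?_
    have hreachw : G.Reachable ![u + t₀, -1] w := ⟨W.takeUntil w hw⟩
    have hwc : G.connectedComponentMk w = cpt := by
      rw [← ht₀]; exact (SimpleGraph.ConnectedComponent.sound hreachw).symm
    have hw0 : w 0 ≠ 0 := hKcol w hwc
    have hwD : 0 ≤ w 0 := (mem_dualRectangle_iff.1 (hsupp W hstart w hw)).1
    omega

/-- **Parity along the bottom row, registered form** of `parity_core'`.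
[cite: BollobasRiordan2006, Ch. 3, Lemma 1 (parity proof of "at least one")] -/
theorem parity_core : ∀ {C : Site 2 → Prop} {m n : ℕ} {u v : ℤ}, (∀ x, C x → 2 ≤ x 0 ∧ x 0 + 1 ≤ m ∧ x 1 + 1 ≤ n) → 2 ≤ u → u ≤ v → ¬ C ![u, 0] → C ![v, 0] → ∃ i k : ℤ, u ≤ i ∧ i < v ∧ (k < u ∨ v ≤ k) ∧ 1 ≤ k ∧ k + 1 ≤ m ∧ (C ![i, 0] ↔ ¬ C ![i + 1, 0]) ∧ (C ![k, 0] ↔ ¬ C ![k + 1, 0]) ∧ (bichromaticGraph C m n).Reachable ![i, -1] ![k, -1] :=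
  fun hC hu2 huv hu hv => parity_core' hC hu2 huv hu hv

end Summit.CriticalPhenomena.CardyFormulaZ2.Cruxes.HalfPlaneMarkDensityLaw.SketchLine.SelfDual
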